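import Summits.QuantumFields.YangMills.Theorems.BalabanUVNodesN15TwoGridCellMean
import Summits.QuantumFields.YangMills.Theorems.BalabanUVNodesN15BackgroundPropagator
import Summits.QuantumFields.YangMills.Theorems.BalabanUVNodesN15TwoGridLandauEntry0Full
import HarnessLib

/-!
# N15 (NE2) — PROGRAMME M «MEAN-ZERO MULTIPLIERS», part M-D: ★★★ THE η-DEFECT OF THE ZEROTH-ORDER-DRESSED PAIR `(X′(c′), X(blockAvg c′))` WITH NO FIT LETTER —
# n15-b's `hasMaj_idef_bgProp` with the oscillation letter `FibreOsc` REPLACED by the source-divergence letters of the `U ≡ 1` fine piece; HYPOTHESIS-FREE FOR BAŁABAN's `Δ_a⁻¹`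

WHO ∕ WHEN.  Cell `pub-ymgap`, seat `pub-ymgap-dag-n15-a` (KNIT-BY-NAME seat of Track-A DAG node N15 = NE2, g24); `--kind proof --supports stmt-QuantumFields-27366 --as helper` (K3⁸;
count-neutral).  Over part M-C `…TwoGridCellMean` (★★★ `hasMaj_comp_idef_mulOp_blockAvg_of_divAdj`), n15-b A1 `…N15BackgroundPropagator` (`bgProp`, `bgProp_fix`, `isUnit_step`, `hasMaj_step`,
`hasMaj_bgProp`, `hasMaj_mulOp_bgProp`, `abs_blockAvg_le`; through it g0 `idef_background_propagator_majorant_flat`, `exists_const_hasMaj_ofBlocks`, `kappa_ofBlocks`, `wrow_of_exp`) and the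
`U ≡ 1` torus letters of parts 36∕39∕52 (`ineq110_114_pair`, `hasMaj_gOp_of_ineq`, `hasMaj_gDivAdj_of_ineq`, ★★★ `hasMaj_twoGridDefect`) BY NAME; nothing in the tree is modified.
WHY.  n15-b's A1 `hasMaj_idef_bgProp` types [B9] (3.62)–(3.65)'s zeroth-order dressing at two spacings: `𝔇(X′(c′), X(blockAvg π c′))` from the `U ≡ 1` letters `(β, δ, m_G)` and the (3.35)
LETTER PAIR of the fine coefficient — sup `|c′| ≤ r` AND the within-block oscillation `FibreOsc π c′ o`, paying `o`.  For the zeroth-order coefficient of (3.52) no `o` with a rate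
follows from (3.35) (it needs (3.36); M-A's header).  THIS FILE removes the oscillation letter: binder (d) of g0's background step (the sandwiched coefficient defect) is supplied by M-C
from the SOURCE-DIVERGENCE letters `G′∘∇′*_κ ≤ C₁e^{−δd}` of the `U ≡ 1` fine piece — for Bałaban's `G′ = Δ′_a⁻¹` these are (1.110) entry 2, in the tree — at the price `2(d+1)·r·L^{−k}·C₁`.
WHAT.  §8 ★★ `hasMaj_idef_bgProp_of_divAdj` (King torus carriers, generic `U ≡ 1` pieces `G, G′` with the four letter kinds `β, m_G, C₁` at rate `δ`, coefficient `|c′| ≤ r` ONLY, smallness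
`βrc_r < 1`): `𝔇(X′(c′), X(blockAvg π c′)) ≤ (m_Gc_r + m_Gc_r·rβ(1−q)⁻¹ + 2(d+1)rL^{−k}C₁·β(1−q)⁻¹·c_r)(1−q)⁻¹·e^{−ρd}` — A1's shape with `β·o ↦ 2(d+1)·r·L^{−k}·C₁`.  §9 ★★★
`hasMaj_idef_bgProp_gOp`: the same for BAŁABAN's FULL PAIR `(G′, G) = (Δ′_a⁻¹, Δ_a⁻¹)` on the torus family of record (`n = L^k`, `n′ = L^mL^k`, `M_ν = 2L^{m_T}`), EVERY `U ≡ 1` letter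
DISCHARGED ((1.110) entries 0∕2 via `ineq110_114_pair`, the η-defect via part 52 `hasMaj_twoGridDefect`): for odd `L ≥ 3`, `a > 0`, `0 < γ < 1` there are `δ, B, r₀ > 0` with
`𝔇(X′(c′), X(blockAvg π c′)) ≤ B·(L^k)^{−γ∕2}·e^{−δ|y−y′|}` for EVERY bounded fine coefficient `|c′| ≤ r ≤ r₀` — the background-LIVE zeroth-order layer with a PRODUCED rate and NO
regularity letter on the background beyond its sup.
HONEST FRAMING ∕ LIMITS.  MECHANISM ((3.62)–(3.65)) + block-majorant bookkeeping over LANDED rows on the `U ≡ 1` torus MODEL carriers (King's pairing, unit blocks, the linearised transport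
(C3) `blockAvg`); scalar ZEROTH-order species `M_c` only (the first-order species `V′₁(A)` of (3.52) is the lineage's `coeffBg₁`∕by-parts road — there the (3.35) gradient letter of `a′` IS
legitimate); nothing of [B5]∕[B6]∕[B9] asserted beyond the cited landed rows; NE2⁺ NOT printed ∕ proved; no statement of record touched; N15 NOT discharged; K3⁸ OPEN; counts UNMOVED (typed
28∕28 · discharged 5∕27); one finite torus pair per index — NOT infinite volume ∕ OS ∕ mass gap ∕ Clay.
-/

noncomputable section

open scoped BigOperators
open Finset

namespace Summit.QuantumFields.YangMills.BalabanUVNodes.N15.TwoGrid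

open Literature.MathematicalPhysics.QuantumFieldTheory.Balaban1983to89
open Literature.MathematicalPhysics.QuantumFieldTheory.Balaban1983to89.B11SectG (BlockNorm HasMaj hasMaj_comp hasMaj_comp_exp RowSum)
open Literature.MathematicalPhysics.QuantumFieldTheory.Balaban1983to89.T4EtaRateDefect (idef)
open Literature.MathematicalPhysics.QuantumFieldTheory.Balaban1983to89.T4EtaRateCoeffDefect (pull pull_apply blockAvg)
open Literature.MathematicalPhysics.QuantumFieldTheory.Balaban1983to89.B9SectDWeightedNeumann (WRow wrow_of_exp)
open Literature.MathematicalPhysics.QuantumFieldTheory.Balaban1983to89.B6RandomWalk (Triangle254)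
open Literature.MathematicalPhysics.QuantumFieldTheory.Balaban1983to89.B6Prop26Gluing (mulOp mulOp_apply)
open Literature.MathematicalPhysics.QuantumFieldTheory.Balaban1983to89.B5Prop11Plancherel (Tor fine unitVec)
open Literature.MathematicalPhysics.QuantumFieldTheory.Balaban1983to89.B5SiteBridgeP12 (MP)
open Literature.MathematicalPhysics.QuantumFieldTheory.King1986.Torus (blockOf tdistT tdistT_nonneg)
open Literature.MathematicalPhysics.QuantumFieldTheory.Balaban1983to89.B6UnitTorusCarrier (unitTorusGeo triangle254_unitTorusGeo rowSum_unitTorusGeo)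
open Summit.QuantumFields.YangMills.BalabanUVNodes.N15.VectorPiece (blkFine kingPrV)
open Summit.QuantumFields.YangMills.BalabanUVNodes.N15.DerivDefect (exists_const_hasMaj_ofBlocks)
open Summit.QuantumFields.YangMills.BalabanUVNodes.N15.BackgroundModel (kappa_ofBlocks)
open Summit.QuantumFields.YangMills.BalabanUVNodes.N15.BackgroundStep (idef_background_propagator_majorant_flat)
open Summit.QuantumFields.YangMills.BalabanUVNodes.N15.BackgroundLayer (bgProp bgProp_fix isUnit_step hasMaj_step hasMaj_bgProp hasMaj_mulOp_bgProp abs_blockAvg_le)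

variable {d : ℕ}

/-! ## §8 ★★ The η-defect of the zeroth-order-dressed pair with NO fit letter (generic `U ≡ 1` pieces on the King torus carriers) -/

section Generic

variable {L : ℕ} [NeZero L] (M : Fin (d + 1) → ℕ) [∀ μ, NeZero (M μ)] (k m : ℕ)

/-- ★★ **THE η-DEFECT OF THE CONSTRUCTED BACKGROUND-DEPENDENT PAIR WITH NO FIT LETTER.**  Carrier `unitTorusGeo L k M` with its (2.61) row sum at `σ ≥ 0` (constant `c_r`); coarse
1-forms on `Tor (fine (L^k) M)` (King blocks), fine 1-forms on `Tor (fine (L^mL^k) M)` (unit blocks), King's pairing `π`.  `U ≡ 1` pieces `G` (coarse), `G′` (fine) with block majorants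
`β·e^{−δd}`, the η-defect `𝔇(G′, G) ≤ m_G·e^{−δd}`, AND the fine source-divergence letters `G′∘ρ′(n′(s_κ⁻¹ − 1)) ≤ C₁·e^{−δd}` (every `κ`); a fine coefficient with ONLY the sup letter
`|c′| ≤ r`; a rate `0 ≤ ρ`, `ρ + σ ≤ δ`; smallness `q = βrc_r < 1`.  CONCLUSION: `𝔇(bgProp G′ c′, bgProp G (blockAvg π c′)) ≤ (m_Gc_r + m_Gc_r·(rβ(1−q)⁻¹) + (2(d+1)rL^{−k}C₁)·(β(1−q)⁻¹)·c_r)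
·(1−q)⁻¹·e^{−ρd}` — n15-b A1 `hasMaj_idef_bgProp` with binder (d) from M-C instead of `FibreOsc`. [cite: Balaban1985BackgroundPropagators, (3.63)–(3.65) pp.402–403 (mechanism), (3.35) p.396;
Balaban1984PropagatorsI, Prop. 1.2 (1.110) p.35 (the letter «G∇*J», shape); King1986, Prop. 3.9 (3.73) p.665 (rate factor L^{−k})] -/
theorem hasMaj_idef_bgProp_of_divAdj {σ cr : ℝ} (hσ : 0 ≤ σ) (hcr : 0 ≤ cr) (hrow : RowSum (unitTorusGeo L k M) σ cr) {ρ δ β r C₁ mG : ℝ} (hρ : 0 ≤ ρ) (hρδ : ρ + σ ≤ δ)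
    (hβ : 0 ≤ β) (hr : 0 ≤ r) (hC₁ : 0 ≤ C₁) (hmG : 0 ≤ mG)
    {G : (Tor (fine (L ^ k) M) × Fin (d + 1) → ℝ) →ₗ[ℝ] (Tor (fine (L ^ k) M) × Fin (d + 1) → ℝ)}
    {G' : (Tor (fine (L ^ m * L ^ k) M) × Fin (d + 1) → ℝ) →ₗ[ℝ] (Tor (fine (L ^ m * L ^ k) M) × Fin (d + 1) → ℝ)} {c' : Tor (fine (L ^ m * L ^ k) M) × Fin (d + 1) → ℝ}
    (hG : HasMaj (BlockNorm.ofBlocks (unitTorusGeo L k M) (blkFine L k M)) (BlockNorm.ofBlocks (unitTorusGeo L k M) (blkFine L k M)) G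
      (fun y y' => β * Real.exp (-(δ * tdistT M y y'))))
    (hG' : HasMaj (BlockNorm.ofBlocks (unitTorusGeo L k M) (fun i : Tor (fine (L ^ m * L ^ k) M) × Fin (d + 1) => blockOf (L ^ m * L ^ k) M i.1))
      (BlockNorm.ofBlocks (unitTorusGeo L k M) (fun i : Tor (fine (L ^ m * L ^ k) M) × Fin (d + 1) => blockOf (L ^ m * L ^ k) M i.1)) G'
      (fun y y' => β * Real.exp (-(δ * tdistT M y y'))))
    (hDG : HasMaj (BlockNorm.ofBlocks (unitTorusGeo L k M) (blkFine L k M))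
      (BlockNorm.ofBlocks (unitTorusGeo L k M) (fun i : Tor (fine (L ^ m * L ^ k) M) × Fin (d + 1) => blockOf (L ^ m * L ^ k) M i.1))
      (idef (pull (kingPrV L k m M)) (pull (kingPrV L k m M)) G' G) (fun y y' => mG * Real.exp (-(δ * tdistT M y y'))))
    (hG'div : ∀ κ : Fin (d + 1), HasMaj (BlockNorm.ofBlocks (unitTorusGeo L k M) (fun i : Tor (fine (L ^ m * L ^ k) M) × Fin (d + 1) => blockOf (L ^ m * L ^ k) M i.1))
      (BlockNorm.ofBlocks (unitTorusGeo L k M) (fun i : Tor (fine (L ^ m * L ^ k) M) × Fin (d + 1) => blockOf (L ^ m * L ^ k) M i.1))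
      (G' ∘ₗ symbOp M (L ^ m * L ^ k) (((L ^ m * L ^ k : ℕ) : ℝ) • (sTinv M (L ^ m * L ^ k) κ - 1))) (fun y y' => C₁ * Real.exp (-(δ * tdistT M y y'))))
    (hc' : ∀ z, |c' z| ≤ r) (hq : β * r * cr < 1) :
    HasMaj (BlockNorm.ofBlocks (unitTorusGeo L k M) (blkFine L k M))
      (BlockNorm.ofBlocks (unitTorusGeo L k M) (fun i : Tor (fine (L ^ m * L ^ k) M) × Fin (d + 1) => blockOf (L ^ m * L ^ k) M i.1))
      (idef (pull (kingPrV L k m M)) (pull (kingPrV L k m M)) (bgProp G' c') (bgProp G (blockAvg (kingPrV L k m M) c')))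
      (fun y y' => (mG * cr + 1 * (mG * cr) * (r * (β * (1 - β * r * cr)⁻¹)) + 2 * (d + 1) * r * (((L ^ k : ℕ) : ℝ))⁻¹ * C₁ * (β * (1 - β * r * cr)⁻¹) * cr) *
        (1 - 1 * (β * r * cr))⁻¹ * Real.exp (-(ρ * tdistT M y y'))) := by
  have htri : Triangle254 (unitTorusGeo L k M) := triangle254_unitTorusGeo L k M
  have hd : ∀ a b : (unitTorusGeo L k M).Site, 0 ≤ (unitTorusGeo L k M).dist a b := fun a b => tdistT_nonneg M a b
  have hσδ : σ ≤ δ := by linarith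
  have hc : ∀ x, |blockAvg (kingPrV L k m M) c' x| ≤ r := abs_blockAvg_le (kingPrV L k m M) hr hc'
  have hq' : 0 < 1 - β * r * cr := by linarith
  have hAX : 0 ≤ β * (1 - β * r * cr)⁻¹ := mul_nonneg hβ (inv_nonneg.2 hq'.le)
  -- the two fixed-point equations (3.65), by construction
  have hfix := bgProp_fix (isUnit_step (g := unitTorusGeo L k M) (blkFine L k M) hd hrow hσδ hβ hr hG hc hq)
  have hfix' := bgProp_fix (isUnit_step (g := unitTorusGeo L k M) (fun i : Tor (fine (L ^ m * L ^ k) M) × Fin (d + 1) => blockOf (L ^ m * L ^ k) M i.1)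
    hd hrow hσδ hβ hr hG' hc' hq)
  -- (b) the fine step and its weighted row norm
  have hK' := hasMaj_step (g := unitTorusGeo L k M) (fun i : Tor (fine (L ^ m * L ^ k) M) × Fin (d + 1) => blockOf (L ^ m * L ^ k) M i.1) hβ hr hG' hc'
  have hwrow' : WRow (unitTorusGeo L k M) ρ (fun y y' => β * r * Real.exp (-(δ * tdistT M y y'))) (β * r * cr) :=
    wrow_of_exp (g := unitTorusGeo L k M) hd hrow (mul_nonneg hβ hr) hρδ
  -- (a) the `U ≡ 1` defect's weighted row norm
  have hwrowG : WRow (unitTorusGeo L k M) ρ (fun y y' => mG * Real.exp (-(δ * tdistT M y y'))) (mG * cr) := wrow_of_exp (g := unitTorusGeo L k M) hd hrow hmG hρδ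
  -- (c) the coarse `VX`
  have hVX := hasMaj_mulOp_bgProp (g := unitTorusGeo L k M) (blkFine L k M) htri hd hrow hσ hρ hρδ hβ hr hG hc hq
  -- (d) THE SANDWICHED COEFFICIENT DEFECT — from M-C, NO fit letter
  have hX := hasMaj_bgProp (g := unitTorusGeo L k M) (blkFine L k M) htri hd hrow hσ hρ hρδ hβ hr hG hc hq
  have hDV0 := hasMaj_comp_idef_mulOp_blockAvg_of_divAdj M k m (K := fun y y' => C₁ * Real.exp (-(δ * tdistT M y y')))
    (fun _ _ => mul_nonneg hC₁ (Real.exp_nonneg _)) hr hc' hG'div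
  have hDV1 : HasMaj (BlockNorm.ofBlocks (unitTorusGeo L k M) (blkFine L k M))
      (BlockNorm.ofBlocks (unitTorusGeo L k M) (fun i : Tor (fine (L ^ m * L ^ k) M) × Fin (d + 1) => blockOf (L ^ m * L ^ k) M i.1))
      (G' ∘ₗ idef (pull (kingPrV L k m M)) (pull (kingPrV L k m M)) (mulOp c') (mulOp (blockAvg (kingPrV L k m M) c')))
      (fun y y' => 2 * (d + 1) * r * (((L ^ k : ℕ) : ℝ))⁻¹ * C₁ * Real.exp (-(δ * (unitTorusGeo L k M).dist y y'))) :=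
    hDV0.mono fun y y' => le_of_eq (by ring)
  have h2c : 0 ≤ 2 * (d + 1) * r * (((L ^ k : ℕ) : ℝ))⁻¹ * C₁ := by positivity
  have hDV2 := hasMaj_comp_exp (b₁ := BlockNorm.ofBlocks (unitTorusGeo L k M) (blkFine L k M)) (b₂ := BlockNorm.ofBlocks (unitTorusGeo L k M) (blkFine L k M))
    (b₃ := BlockNorm.ofBlocks (unitTorusGeo L k M) (fun i : Tor (fine (L ^ m * L ^ k) M) × Fin (d + 1) => blockOf (L ^ m * L ^ k) M i.1))
    htri hd hrow h2c hAX hρ le_rfl hρδ hDV1 hX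
  have hDV : HasMaj (BlockNorm.ofBlocks (unitTorusGeo L k M) (blkFine L k M))
      (BlockNorm.ofBlocks (unitTorusGeo L k M) (fun i : Tor (fine (L ^ m * L ^ k) M) × Fin (d + 1) => blockOf (L ^ m * L ^ k) M i.1))
      (G' ∘ₗ idef (pull (kingPrV L k m M)) (pull (kingPrV L k m M)) (mulOp c') (mulOp (blockAvg (kingPrV L k m M) c')) ∘ₗ bgProp G (blockAvg (kingPrV L k m M) c'))
      (fun y y' => 2 * (d + 1) * r * (((L ^ k : ℕ) : ℝ))⁻¹ * C₁ * (β * (1 - β * r * cr)⁻¹) * cr * Real.exp (-(ρ * (unitTorusGeo L k M).dist y y'))) := by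
    refine hDV2.mono fun a b => le_of_eq ?_
    rw [kappa_ofBlocks]
    ring
  -- (f) a priori
  obtain ⟨M₀, hM₀, hap⟩ := exists_const_hasMaj_ofBlocks (g := unitTorusGeo L k M) (blkFine L k M)
    (fun i : Tor (fine (L ^ m * L ^ k) M) × Fin (d + 1) => blockOf (L ^ m * L ^ k) M i.1)
    (idef (pull (kingPrV L k m M)) (pull (kingPrV L k m M)) (bgProp G' c') (bgProp G (blockAvg (kingPrV L k m M) c')))
  have hq2 : (BlockNorm.ofBlocks (unitTorusGeo L k M) (fun i : Tor (fine (L ^ m * L ^ k) M) × Fin (d + 1) => blockOf (L ^ m * L ^ k) M i.1)).κ * (β * r * cr) < 1 := by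
    rw [kappa_ofBlocks, one_mul]; exact hq
  -- THE BACKGROUND STEP (g0 file 5, flat weights)
  have key := idef_background_propagator_majorant_flat (b₁ := BlockNorm.ofBlocks (unitTorusGeo L k M) (blkFine L k M))
    (b₂' := BlockNorm.ofBlocks (unitTorusGeo L k M) (fun i : Tor (fine (L ^ m * L ^ k) M) × Fin (d + 1) => blockOf (L ^ m * L ^ k) M i.1))
    (τ₁ := pull (kingPrV L k m M)) (τ₂ := pull (kingPrV L k m M)) (G₁ := G) (Xc := bgProp G (blockAvg (kingPrV L k m M) c')) (V := mulOp (blockAvg (kingPrV L k m M) c'))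
    (G₁' := G') (Xf := bgProp G' c') (V' := mulOp c') (ρ := ρ) htri hd hρ (mul_nonneg hr hAX)
    (mul_nonneg (mul_nonneg h2c hAX) hcr) hM₀
    (fun _ _ => mul_nonneg (mul_nonneg hβ hr) (Real.exp_nonneg _)) hwrow' (fun _ _ => mul_nonneg hmG (Real.exp_nonneg _)) hwrowG
    hfix hfix' hK' hVX hDG hDV hap hq2
  refine key.mono fun a b => le_of_eq ?_
  rfl

end Generic

/-! ## §9 ★★★ Hypothesis-free for Bałaban's full `U ≡ 1` pair `(Δ′_a⁻¹, Δ_a⁻¹)` on the torus family of record -/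

section Balaban

/-- constants bookkeeping for §9: the three terms of §8's constant are each `≤ (…)·θ` once `r ≤ r₀`, `(1 − Crc_r)⁻¹ ≤ 2`, `x ≤ θ ≤ 1` (`x = L^{−k}`, `θ = (L^k)^{−γ∕2}`). [folklore] -/
theorem noFit_const_bound {D C cr r r₀ θ x dd : ℝ} (hD : 0 ≤ D) (hC : 0 ≤ C) (hcr : 0 ≤ cr) (hr : 0 ≤ r) (hrr₀ : r ≤ r₀) (hdd : 0 ≤ dd) (hθ : 0 ≤ θ)
    (hx : 0 ≤ x) (hxθ : x ≤ θ) (hq0 : 0 ≤ (1 - C * r * cr)⁻¹) (hq2 : (1 - C * r * cr)⁻¹ ≤ 2) :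
    (D * θ * cr + 1 * (D * θ * cr) * (r * (C * (1 - C * r * cr)⁻¹)) + 2 * dd * r * x * C * (C * (1 - C * r * cr)⁻¹) * cr) * (1 - 1 * (C * r * cr))⁻¹
      ≤ ((D * cr + D * cr * (r₀ * (C * 2)) + 2 * dd * r₀ * C * (C * 2) * cr) * 2 + 1) * θ := by
  have hr₀ : 0 ≤ r₀ := hr.trans hrr₀
  have hrc : r * (C * (1 - C * r * cr)⁻¹) ≤ r₀ * (C * 2) := mul_le_mul hrr₀ (mul_le_mul_of_nonneg_left hq2 hC) (by positivity) hr₀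
  have t2 : 1 * (D * θ * cr) * (r * (C * (1 - C * r * cr)⁻¹)) ≤ D * cr * (r₀ * (C * 2)) * θ := by
    calc 1 * (D * θ * cr) * (r * (C * (1 - C * r * cr)⁻¹)) = (D * cr * θ) * (r * (C * (1 - C * r * cr)⁻¹)) := by ring
      _ ≤ (D * cr * θ) * (r₀ * (C * 2)) := mul_le_mul_of_nonneg_left hrc (by positivity)
      _ = D * cr * (r₀ * (C * 2)) * θ := by ring
  have t3 : 2 * dd * r * x * C * (C * (1 - C * r * cr)⁻¹) * cr ≤ 2 * dd * r₀ * C * (C * 2) * cr * θ := by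
    calc 2 * dd * r * x * C * (C * (1 - C * r * cr)⁻¹) * cr = (2 * dd * C * cr) * (r * (C * (1 - C * r * cr)⁻¹)) * x := by ring
      _ ≤ (2 * dd * C * cr) * (r₀ * (C * 2)) * θ := mul_le_mul (mul_le_mul_of_nonneg_left hrc (by positivity)) hxθ hx (by positivity)
      _ = 2 * dd * r₀ * C * (C * 2) * cr * θ := by ring
  have hA : D * θ * cr + 1 * (D * θ * cr) * (r * (C * (1 - C * r * cr)⁻¹)) + 2 * dd * r * x * C * (C * (1 - C * r * cr)⁻¹) * cr ≤
      (D * cr + D * cr * (r₀ * (C * 2)) + 2 * dd * r₀ * C * (C * 2) * cr) * θ := by nlinarith [t2, t3]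
  have hS : 0 ≤ (D * cr + D * cr * (r₀ * (C * 2)) + 2 * dd * r₀ * C * (C * 2) * cr) * θ := by positivity
  rw [one_mul (C * r * cr)]
  calc _ ≤ ((D * cr + D * cr * (r₀ * (C * 2)) + 2 * dd * r₀ * C * (C * 2) * cr) * θ) * 2 := mul_le_mul hA hq2 hq0 hS
    _ ≤ _ := by nlinarith [hθ]

variable (d)

/-- ★★★ **THE BACKGROUND-LIVE ZEROTH-ORDER LAYER WITH A PRODUCED RATE AND NO REGULARITY LETTER ON THE BACKGROUND BEYOND ITS SUP.**  For odd `L ≥ 3`, `a > 0` and `0 < γ < 1` there are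
`δ, r₀, B > 0` such that for EVERY volume exponent `m_T`, coarse scale `k ≥ 1`, refinement exponent `m`, and EVERY fine coefficient `c′` with `|c′| ≤ r ≤ r₀` (`0 ≤ r`): the η-defect of the
zeroth-order-dressed pair built on BAŁABAN's full propagators `G = Δ_a⁻¹` (spacing `L^{−k}`) and `G′ = Δ′_a⁻¹` (spacing `L^{−(m+k)}`), fine coefficient `c′`, coarse coefficient its block average,
obeys `𝔇(X′(c′), X(blockAvg π c′)) ≤ B·(L^k)^{−γ∕2}·e^{−δ|y−y′|_T}`.  Every `U ≡ 1` letter is a tree theorem: (1.110) entries 0 and 2 on both grids (`ineq110_114_pair`,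
`hasMaj_gOp_of_ineq`, `hasMaj_gDivAdj_of_ineq`), the η-defect `𝔇(G′, G) ≤ C(L^k)^{−γ∕2}e^{−δd}` (part 52 `hasMaj_twoGridDefect`); the rate of the coefficient term is `L^{−k} ≤ (L^k)^{−γ∕2}`.
[cite: Balaban1985BackgroundPropagators, (3.35) p.396, (3.62)–(3.65) pp.402–403 (mechanism); Balaban1984PropagatorsI, Prop. 1.2 (1.110) p.35; King1986, Prop. 3.9 (3.73) p.665 (rate factor)] -/
theorem hasMaj_idef_bgProp_gOp {L : ℕ} [NeZero L] (hLodd : Odd L) (hL3 : 3 ≤ L) {a : ℝ} (ha : 0 < a) {γ : ℝ} (hγ0 : 0 < γ) (hγ1 : γ < 1) :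
    ∃ δ r₀ B : ℝ, 0 < δ ∧ 0 < r₀ ∧ 0 < B ∧ ∀ (mT k m : ℕ) (hk : 1 ≤ k) (hL : Odd L ∧ 1 < L) (r : ℝ) (_hr : 0 ≤ r) (_hr₀ : r ≤ r₀)
      (c' : Tor (fine (L ^ m * L ^ k) (MP (paramsOf d L mT k hL))) × Fin (d + 1) → ℝ) (_hc' : ∀ z, |c' z| ≤ r),
      HasMaj (BlockNorm.ofBlocks (unitTorusGeo L k (MP (paramsOf d L mT k hL))) (blkFine L k (MP (paramsOf d L mT k hL))))
        (BlockNorm.ofBlocks (unitTorusGeo L k (MP (paramsOf d L mT k hL)))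
          (fun i : Tor (fine (L ^ m * L ^ k) (MP (paramsOf d L mT k hL))) × Fin (d + 1) => blockOf (L ^ m * L ^ k) (MP (paramsOf d L mT k hL)) i.1))
        (idef (pull (kingPrV L k m (MP (paramsOf d L mT k hL)))) (pull (kingPrV L k m (MP (paramsOf d L mT k hL))))
          (bgProp (gOp (MP (paramsOf d L mT k hL)) (L ^ m * L ^ k) a) c')
          (bgProp (gOp (MP (paramsOf d L mT k hL)) (L ^ k) a) (blockAvg (kingPrV L k m (MP (paramsOf d L mT k hL))) c')))
        (fun y y' => B * ((L ^ k : ℕ) : ℝ) ^ (-(γ / 2)) * Real.exp (-(δ * tdistT (MP (paramsOf d L mT k hL)) y y'))) := by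
  have hL2 : 2 ≤ L := by omega
  have hL : Odd L ∧ 1 < L := ⟨hLodd, by omega⟩
  -- the `U ≡ 1` letters of record
  obtain ⟨δ₀, C, Cα, Cε, Cαε, hδ₀, hC, H110⟩ := ineq110_114_pair (d := d) hL ha
  obtain ⟨δ₁, D, hδ₁, hD, HDef⟩ := hasMaj_twoGridDefect (d := d) hLodd hL2 ha hγ0 hγ1
  -- rates `ρ := δ∕2`, `σ := δ∕2`, `δ := min δ₀ δ₁`; smallness window `r₀`
  have hδ : 0 < min δ₀ δ₁ := lt_min hδ₀ hδ₁
  have hσ : 0 < min δ₀ δ₁ / 2 := by positivity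
  have hcr : 0 ≤ B4Sect5Proof.latticeConst (d + 1) (min δ₀ δ₁ / 2) := B4Sect5Proof.latticeConst_nonneg (d + 1) hσ.le
  have hr₀ : 0 < (2 * (C * B4Sect5Proof.latticeConst (d + 1) (min δ₀ δ₁ / 2) + 1))⁻¹ := by positivity
  refine ⟨min δ₀ δ₁ / 2, (2 * (C * B4Sect5Proof.latticeConst (d + 1) (min δ₀ δ₁ / 2) + 1))⁻¹,
    (D * B4Sect5Proof.latticeConst (d + 1) (min δ₀ δ₁ / 2) + D * B4Sect5Proof.latticeConst (d + 1) (min δ₀ δ₁ / 2) *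
      ((2 * (C * B4Sect5Proof.latticeConst (d + 1) (min δ₀ δ₁ / 2) + 1))⁻¹ * (C * 2)) +
      2 * ((d : ℝ) + 1) * (2 * (C * B4Sect5Proof.latticeConst (d + 1) (min δ₀ δ₁ / 2) + 1))⁻¹ * C * (C * 2) * B4Sect5Proof.latticeConst (d + 1) (min δ₀ δ₁ / 2)) * 2 + 1,
    hσ, hr₀, by positivity, ?_⟩
  intro mT k m hk hL' r hr hrr₀ c' hc'
  have hkpos : (0 : ℝ) < ((L ^ k : ℕ) : ℝ) := by positivity
  have hn : 1 ≤ L ^ k := Nat.one_le_pow _ _ (by omega)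
  have hn' : 1 ≤ L ^ m * L ^ k := Nat.one_le_iff_ne_zero.mpr (NeZero.ne _)
  have hmono : ∀ {F₁ F₂ : Type} [AddCommGroup F₁] [Module ℝ F₁] [AddCommGroup F₂] [Module ℝ F₂]
      {b₁ : BlockNorm (unitTorusGeo L k (MP (paramsOf d L mT k hL'))) F₁} {b₂ : BlockNorm (unitTorusGeo L k (MP (paramsOf d L mT k hL'))) F₂} {T : F₁ →ₗ[ℝ] F₂} {A t : ℝ},
      0 ≤ A → min δ₀ δ₁ ≤ t → HasMaj b₁ b₂ T (fun y y' => A * Real.exp (-(t * tdistT (MP (paramsOf d L mT k hL')) y y'))) →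
      HasMaj b₁ b₂ T (fun y y' => A * Real.exp (-(min δ₀ δ₁ * tdistT (MP (paramsOf d L mT k hL')) y y'))) :=
    fun hA ht h => h.mono fun y y' => mul_le_mul_of_nonneg_left (Real.exp_le_exp.mpr (by nlinarith [tdistT_nonneg (MP (paramsOf d L mT k hL')) y y'])) hA
  obtain ⟨Hc, Hf⟩ := H110 mT k m hk
  have hG := hmono hC.le (min_le_left _ _) (hasMaj_gOp_of_ineq (MP (paramsOf d L mT k hL')) k (L ^ k) a hn Hc hC.le)
  have hG' := hmono hC.le (min_le_left _ _) (hasMaj_gOp_of_ineq (MP (paramsOf d L mT k hL')) k (L ^ m * L ^ k) a hn' Hf hC.le)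
  have hG'div := fun κ : Fin (d + 1) => hmono hC.le (min_le_left _ _) (hasMaj_gDivAdj_of_ineq (MP (paramsOf d L mT k hL')) k (L ^ m * L ^ k) a hn' Hf hC.le κ)
  have hDk : 0 ≤ D * ((L ^ k : ℕ) : ℝ) ^ (-(γ / 2)) := mul_nonneg hD.le (Real.rpow_nonneg hkpos.le _)
  have hDG := hmono hDk (min_le_right _ _) (HDef mT k m hk hL')
  -- smallness `C r c_r ≤ 1∕2`
  have h1 : r * (2 * (C * B4Sect5Proof.latticeConst (d + 1) (min δ₀ δ₁ / 2) + 1)) ≤ 1 := by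
    have := mul_le_mul_of_nonneg_right hrr₀ (by positivity : (0 : ℝ) ≤ 2 * (C * B4Sect5Proof.latticeConst (d + 1) (min δ₀ δ₁ / 2) + 1))
    rwa [inv_mul_cancel₀ (by positivity : (2 * (C * B4Sect5Proof.latticeConst (d + 1) (min δ₀ δ₁ / 2) + 1) : ℝ) ≠ 0)] at this
  have hCrc : 0 ≤ C * (r * B4Sect5Proof.latticeConst (d + 1) (min δ₀ δ₁ / 2)) := mul_nonneg hC.le (mul_nonneg hr hcr)
  have hq : C * r * B4Sect5Proof.latticeConst (d + 1) (min δ₀ δ₁ / 2) < 1 := by nlinarith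
  have hhalf : 1 / 2 ≤ 1 - C * r * B4Sect5Proof.latticeConst (d + 1) (min δ₀ δ₁ / 2) := by nlinarith
  have hq2 : (1 - C * r * B4Sect5Proof.latticeConst (d + 1) (min δ₀ δ₁ / 2))⁻¹ ≤ 2 := by
    calc (1 - C * r * B4Sect5Proof.latticeConst (d + 1) (min δ₀ δ₁ / 2))⁻¹ ≤ (1 / 2)⁻¹ := inv_anti₀ (by norm_num) hhalf
      _ = 2 := by norm_num
  have hq0 : 0 ≤ (1 - C * r * B4Sect5Proof.latticeConst (d + 1) (min δ₀ δ₁ / 2))⁻¹ := inv_nonneg.mpr (by linarith)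
  have key := hasMaj_idef_bgProp_of_divAdj (MP (paramsOf d L mT k hL')) k m hσ.le hcr (rowSum_unitTorusGeo L k (MP (paramsOf d L mT k hL')) hσ)
    (ρ := min δ₀ δ₁ / 2) (δ := min δ₀ δ₁) hσ.le (by linarith) hC.le hr hC.le hDk hG hG' hDG hG'div hc' hq
  -- `L^{−k} ≤ (L^k)^{−γ∕2} ≤ 1`
  have hrate : (((L ^ k : ℕ) : ℝ))⁻¹ ≤ ((L ^ k : ℕ) : ℝ) ^ (-(γ / 2)) := by
    rw [← Real.rpow_neg_one]
    exact Real.rpow_le_rpow_of_exponent_le (by exact_mod_cast hn) (by linarith)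
  have hθ := Real.rpow_nonneg hkpos.le (-(γ / 2))
  have hbd := noFit_const_bound (dd := (d : ℝ) + 1) hD.le hC.le hcr hr hrr₀ (by positivity) hθ (inv_nonneg.mpr hkpos.le) hrate hq0 hq2
  refine key.mono fun y y' => ?_
  have hE := Real.exp_nonneg (-(min δ₀ δ₁ / 2 * tdistT (MP (paramsOf d L mT k hL')) y y'))
  have e1 : D * ((L ^ k : ℕ) : ℝ) ^ (-(γ / 2)) * B4Sect5Proof.latticeConst (d + 1) (min δ₀ δ₁ / 2) +
        1 * (D * ((L ^ k : ℕ) : ℝ) ^ (-(γ / 2)) * B4Sect5Proof.latticeConst (d + 1) (min δ₀ δ₁ / 2)) * (r * (C * (1 - C * r * B4Sect5Proof.latticeConst (d + 1) (min δ₀ δ₁ / 2))⁻¹)) +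
        2 * (d + 1) * r * (((L ^ k : ℕ) : ℝ))⁻¹ * C * (C * (1 - C * r * B4Sect5Proof.latticeConst (d + 1) (min δ₀ δ₁ / 2))⁻¹) * B4Sect5Proof.latticeConst (d + 1) (min δ₀ δ₁ / 2) =
      D * ((L ^ k : ℕ) : ℝ) ^ (-(γ / 2)) * B4Sect5Proof.latticeConst (d + 1) (min δ₀ δ₁ / 2) +
        1 * (D * ((L ^ k : ℕ) : ℝ) ^ (-(γ / 2)) * B4Sect5Proof.latticeConst (d + 1) (min δ₀ δ₁ / 2)) * (r * (C * (1 - C * r * B4Sect5Proof.latticeConst (d + 1) (min δ₀ δ₁ / 2))⁻¹)) +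
        2 * ((d : ℝ) + 1) * r * (((L ^ k : ℕ) : ℝ))⁻¹ * C * (C * (1 - C * r * B4Sect5Proof.latticeConst (d + 1) (min δ₀ δ₁ / 2))⁻¹) * B4Sect5Proof.latticeConst (d + 1) (min δ₀ δ₁ / 2) := by
    push_cast; ring
  rw [e1]
  exact mul_le_mul_of_nonneg_right hbd hE

end Balaban

end Summit.QuantumFields.YangMills.BalabanUVNodes.N15.TwoGrid

end
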